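import Summits.BirchSwinnertonDyer.Rank1Residual.P2.CMImageBoardAtTwo
import Summits.BirchSwinnertonDyer.Rank1Residual.Partition.CornersCMDecide
import Literature.NumberTheory.EllipticCurves.HuShuYin2019.SylvesterThreePart
import Literature.NumberTheory.EllipticCurves.TwoTorsionCardProofs
import Literature.NumberTheory.EllipticCurves.BSDSelmerSmithNoRationalTwoTorsionCMProofs
import HarnessLib

/-!
# The habitat binder `ρ̄_{E,2}` onto of the line `CMKolyvaginAtInertTwo`, in MODEL currency:
# for `j = 0` it is «`2c₆` is not a rational cube» (`y² = x³ + B`: «`B` is not a cube»; cube sums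
# `x³ + y³ = n` with `n` odd: always); `j = 1728`: never; CM `j ∉ {0, 1728}` inert at `2`: iff `j ≠ 54000`

Cell `bsd-print-cf2` (D-0131 (2) print tier, leaf «CornerF @ p = 2» =
`Summit.BirchSwinnertonDyer.WAllCornerFTwo`), typer seat ty2 (the DISCHARGE INTERFACE: leaf /
habitat predicate ⟹ the hypotheses the line's theorems consume, sorry-free). The ideator line
`route-BirchSwinnertonDyer-CMKolyvaginAtInertTwo` on this leaf quantifies its cruxes
(`CMPrimitiveSupplyAtInertTwo`, `CMKolyvaginExactAtInertTwo`, `CMExactDescentAtTwo`, residual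
`OffHabitatCMResidualAtTwo`) over the habitat
`H₂ = (HasCM ∧ CMInert W 2 ∧ W.HasSurjectiveModNGaloisRep 2 ∧ Odd ∏c_ℓ ∧ odd Manin)`.
The binder `W.HasSurjectiveModNGaloisRep 2` («`ρ̄_{E,2}` onto `GL₂(𝔽₂)`») is decided here on the
models the cell works with, from the tree theorem `hasSurjectiveModNGaloisRep_two_iff`
(Dokchitser–Dokchitser 2012 (1): onto ⟺ no rational point of order `2` ∧ `Δ ∉ ℚ^{×2}`) and the
`2`-division cubic in Silverman's `c`-form `X³ − 27c₄X − 54c₆` (`X = 36x + 3b₂`):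

* §1 `exists_cCubic_root_of_two_nsmul_eq_zero` — a rational point `P ≠ O`, `2P = O` gives a rational
  root of `X³ − 27c₄X − 54c₆` (converse of the tree's `X12.exists_twoTorsion_of_cCubic_root`).
* §2 **`j = 0` (`c₄ = 0`)**: `forall_two_nsmul_iff_not_exists_cube_of_c₄_eq_zero` — «no rational
  point of order `2` ⟺ `2c₆ ∉ ℚ³`», and **`hasSurjectiveModNGaloisRep_two_iff_of_c₄_eq_zero`** —
  «`ρ̄_{E,2}` onto ⟺ `2c₆ ∉ ℚ³`» (`Δ = −c₆²/1728 < 0` is never a square); `j`-form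
  `hasSurjectiveModNGaloisRep_two_iff_of_j_eq_zero`. The criterion is visibly model-independent
  (`c₆ ↦ u⁻⁶c₆`).
* §3 the sextic models `y² = x³ + B`: **`hasSurjectiveModNGaloisRep_two_sextic_iff`** —
  onto ⟺ `B ∉ ℚ³` (`2c₆ = (−12)³·B`); a valuation obstruction `not_exists_pow_three_eq_of_padicValRat`
  (`3 ∤ ord_p B` ⟹ `B ∉ ℚ³`); the CUBE-SUM curves `x³ + y³ = n` (`HuShuYin2019.cubeSumCurve n`,
  `y² = x³ − 432n²`): for `n` an ODD integer `ord₂(−432n²) = 4`, so `ρ̄_{E,2}` is onto on every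
  `ℚ`-model (`hasSurjectiveModNGaloisRep_two_of_smul_cubeSumCurve_of_odd`), while `x³ + y³ = 2`
  (`36a1`, `−432·4 = (−12)³`) is not onto.
* §4 `j = 1728` (`c₆ = 0`, the curves `y² = x³ + Ax`, CM by `ℤ[i]`, `2` RAMIFIED): never onto
  (`not_hasSurjectiveModNGaloisRep_two_of_j_eq_1728`) — the congruent-number corner is off `H₂`.
* §5 CM with `j ≠ 0` and `2` INERT in the CM field (`CMInert W 2`, i.e. `d ∈ {−3, −11, −19, −43,
  −67, −163}`): onto ⟺ `j ≠ 54000` (`hasSurjectiveModNGaloisRep_two_iff_of_cmInert_two_of_j_ne_zero`,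
  from the tree's rational-`2`-torsion table `X12.exists_twoTorsion_iff_of_cm_j_ne_zero` and
  `P2.hasSurjectiveModNGaloisRep_two_of_hasCM`); the whole inert slice in one statement
  `hasSurjectiveModNGaloisRep_two_iff_of_cmInert_two`.

HONEST FRAMING: nothing here proves `BSD(W,2)` for any curve; no class of the corner is closed; the
Tamagawa-parity and Manin binders of `H₂` are not addressed. THEOREMS ONLY (no definition, no named
fact, no axiom, no `sorry`). beyond-print theorem: NO (Dokchitser–Dokchitser (1) + Silverman III §1).

References: [DokchitserDokchitserMathZ2012] Theorem (1); [SilvermanAEC2009] III §1 (`c₄`, `c₆`,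
the cubic `x³ − 27c₄x − 54c₆`), X §1 (`ℚ(E[2])`); [HuShuYin2019] p. 4 (`E_n : y² = x³ − 432n²`);
[GrossLMS1991] §2 (the hypothesis «`Gal(ℚ(E_p)/ℚ) ≅ GL₂(ℤ/pℤ)`»); tree `P2/CMImageBoardAtTwo.lean`,
`X12/CMTwoTorsion*.lean`, `Literature/…/TwoTorsionOddDegreeBaseChangeProofs.lean` (this seat, the
field-generic `b`-cubic form) and `Literature/…/BSDSelmerSmithNoRationalTwoTorsionCMProofs.lean`
(`ratTwoTorsionCard_j_zero_model_eq_one_iff`, the same sextic fact in the `ratTwoTorsionCard` currency).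
-/

set_option autoImplicit false

noncomputable section

open scoped Classical

open WeierstrassCurve Polynomial Literature.NumberTheory.EllipticCurves
  Literature.NumberTheory.EllipticCurves.Rank1Residual

namespace Summit.BirchSwinnertonDyer.Rank1Residual.P2

variable (W : WeierstrassCurve ℚ) [W.IsElliptic]

/-! ## §1 A rational point of order `2` gives a root of `X³ − 27c₄X − 54c₆` -/

omit [W.IsElliptic] in
/-- **`P ≠ O`, `2P = O` ⟹ `X³ − 27c₄X − 54c₆` has the rational root `X = 36·x(P) + 3b₂`**: `x(P)` is
a root of the `2`-division cubic `4x³ + b₂x² + 2b₄x + b₆` (tree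
`isRoot_twoTorsionPolynomial_of_add_self_eq_zero`), and
`11664·(4x³ + b₂x² + 2b₄x + b₆) = X³ − 27c₄X − 54c₆` for `X = 36x + 3b₂` (Silverman *AEC* III §1).
[cite: SilvermanAEC2009, III §1 and Ex. III.3.7 (d)] -/
theorem exists_cCubic_root_of_two_nsmul_eq_zero {P : W.toAffine.Point} (hP0 : P ≠ 0)
    (h2P : 2 • P = 0) : ∃ X : ℚ, X ^ 3 - 27 * W.c₄ * X - 54 * W.c₆ = 0 := by
  rcases P with _ | ⟨x, y, h⟩
  · exact absurd rfl hP0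
  · have h2P' : Affine.Point.some x y h + Affine.Point.some x y h = 0 := by
      rw [← two_nsmul]; exact h2P
    -- the tree lemma is stated with the classical `DecidableEq ℚ` behind the group law; `convert`
    -- bridges it with `Rat`'s instance used here
    have hroot := (W.isRoot_twoTorsionPolynomial_of_add_self_eq_zero (x := x) (y := y) (h := h)
      (by convert h2P')).2
    have hx : 4 * x ^ 3 + W.b₂ * x ^ 2 + 2 * W.b₄ * x + W.b₆ = 0 := by
      simpa only [twoTorsionPolynomial, Cubic.toPoly, IsRoot.def, eval_add, eval_mul, eval_C,
        eval_pow, eval_X] using hroot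
    refine ⟨36 * x + 3 * W.b₂, ?_⟩
    simp only [c₄, c₆]
    linear_combination (11664 : ℚ) * hx

/-- **No rational point of order `2` ⟺ `X³ − 27c₄X − 54c₆` has no rational root** (with the tree's
converse `X12.exists_twoTorsion_of_cCubic_root`). [cite: SilvermanAEC2009, III §1 and Ex. III.3.7 (d)] -/
theorem forall_two_nsmul_iff_forall_cCubic_ne_zero :
    (∀ P : W.toAffine.Point, 2 • P = 0 → P = 0) ↔
      ∀ X : ℚ, X ^ 3 - 27 * W.c₄ * X - 54 * W.c₆ ≠ 0 := by
  constructor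
  · intro hno X hX
    obtain ⟨P, hP0, h2P⟩ := X12.exists_twoTorsion_of_cCubic_root W X hX
    exact hP0 (hno P h2P)
  · intro hX P h2P
    by_contra hP0
    obtain ⟨X, hX'⟩ := exists_cCubic_root_of_two_nsmul_eq_zero W hP0 h2P
    exact hX X hX'

/-! ## §2 `j = 0`: `ρ̄_{E,2}` onto ⟺ `2c₆` is not a rational cube -/

omit [W.IsElliptic] in
/-- For `c₄ = 0`: `X³ − 54c₆` has a rational root iff `2c₆` is a rational cube (`X = 3t`). [folklore] -/
theorem exists_cCubic_root_iff_exists_cube_of_c₄_eq_zero (hc₄ : W.c₄ = 0) :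
    (∃ X : ℚ, X ^ 3 - 27 * W.c₄ * X - 54 * W.c₆ = 0) ↔ ∃ t : ℚ, t ^ 3 = 2 * W.c₆ := by
  rw [hc₄]
  constructor
  · rintro ⟨X, hX⟩
    exact ⟨X / 3, by linear_combination (1 / 27 : ℚ) * hX⟩
  · rintro ⟨t, ht⟩
    exact ⟨3 * t, by linear_combination (27 : ℚ) * ht⟩

/-- **`j = 0` (`c₄ = 0`): no rational point of order `2` ⟺ `2c₆ ∉ ℚ³.** For an elliptic curve over
`ℚ` with `c₄ = 0` the `2`-division cubic in `c`-form is `X³ − 54c₆`; on `y² = x³ + B` (`c₆ = −864B`)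
this is «`E(ℚ)[2] ≠ 0` iff `B` is a cube». [cite: SilvermanAEC2009, III §1 and X §1 (ℚ(E[2]))] -/
theorem forall_two_nsmul_iff_not_exists_cube_of_c₄_eq_zero (hc₄ : W.c₄ = 0) :
    (∀ P : W.toAffine.Point, 2 • P = 0 → P = 0) ↔ ¬ ∃ t : ℚ, t ^ 3 = 2 * W.c₆ := by
  rw [forall_two_nsmul_iff_forall_cCubic_ne_zero, ← exists_cCubic_root_iff_exists_cube_of_c₄_eq_zero W hc₄,
    not_exists]

/-- For an elliptic curve, `j = 0 ⟺ c₄ = 0` (`j = c₄³/Δ`). [cite: SilvermanAEC2009, III §1] -/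
theorem j_eq_zero_iff_c₄_eq_zero : W.j = 0 ↔ W.c₄ = 0 := by
  have hΔ : W.Δ ≠ 0 := W.isUnit_Δ.ne_zero
  have h := X12.j_mul_Δ_eq W
  constructor
  · intro hj
    rw [hj, zero_mul] at h
    exact pow_eq_zero_iff (three_ne_zero) |>.mp h.symm
  · intro hc
    rw [hc, zero_pow three_ne_zero] at h
    exact (mul_eq_zero.mp h).resolve_right hΔ

/-- `c₄ = 0 ⟹ Δ = −c₆²/1728 ∉ ℚ^{×2}` (`1728Δ = c₄³ − c₆²`; also `j = 0 < 1728`, tree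
`not_isSquare_Δ_of_j_lt`). [cite: SilvermanAEC2009, III §1] -/
theorem not_isSquare_Δ_of_c₄_eq_zero (hc₄ : W.c₄ = 0) : ¬ IsSquare W.Δ :=
  not_isSquare_Δ_of_j_lt W (by rw [(j_eq_zero_iff_c₄_eq_zero W).mpr hc₄]; norm_num)

/-- **`j = 0`: `ρ̄_{E,2}` is onto `GL₂(𝔽₂)` iff `2c₆` is not a rational cube.** Dokchitser–Dokchitser
(1) (`hasSurjectiveModNGaloisRep_two_iff`: onto ⟺ no rational `2`-torsion ∧ `Δ ∉ ℚ^{×2}`) with §2: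
for `c₄ = 0` the square condition is automatic. The criterion is model-independent (`c₆ ↦ u⁻⁶c₆`
multiplies `2c₆` by the cube `(u⁻²)³`). [cite: DokchitserDokchitserMathZ2012, Theorem (1)]
[cite: SilvermanAEC2009, III §1] -/
theorem hasSurjectiveModNGaloisRep_two_iff_of_c₄_eq_zero (hc₄ : W.c₄ = 0) :
    W.HasSurjectiveModNGaloisRep 2 ↔ ¬ ∃ t : ℚ, t ^ 3 = 2 * W.c₆ := by
  rw [hasSurjectiveModNGaloisRep_two_iff W, forall_two_nsmul_iff_not_exists_cube_of_c₄_eq_zero W hc₄]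
  exact ⟨fun h ↦ h.1, fun h ↦ ⟨h, not_isSquare_Δ_of_c₄_eq_zero W hc₄⟩⟩

/-- **`j = 0`: `ρ̄_{E,2}` onto ⟺ `2c₆ ∉ ℚ³`**, `j`-form. [cite: DokchitserDokchitserMathZ2012, Theorem (1)]
[cite: SilvermanAEC2009, III §1] -/
theorem hasSurjectiveModNGaloisRep_two_iff_of_j_eq_zero (hj : W.j = 0) :
    W.HasSurjectiveModNGaloisRep 2 ↔ ¬ ∃ t : ℚ, t ^ 3 = 2 * W.c₆ :=
  hasSurjectiveModNGaloisRep_two_iff_of_c₄_eq_zero W ((j_eq_zero_iff_c₄_eq_zero W).mp hj)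

/-! ## §3 The sextic models `y² = x³ + B` and the cube-sum curves `x³ + y³ = n` -/

section Sextic

/-- `c₄(y² = x³ + B) = 0`. [folklore] -/
theorem c₄_mk_a₆ (B : ℚ) : (⟨0, 0, 0, 0, B⟩ : WeierstrassCurve ℚ).c₄ = 0 := by
  simp only [WeierstrassCurve.c₄, WeierstrassCurve.b₂, WeierstrassCurve.b₄]
  ring

/-- `c₆(y² = x³ + B) = −864B`. [folklore] -/
theorem c₆_mk_a₆ (B : ℚ) : (⟨0, 0, 0, 0, B⟩ : WeierstrassCurve ℚ).c₆ = -864 * B := by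
  simp only [WeierstrassCurve.c₆, WeierstrassCurve.b₂, WeierstrassCurve.b₄, WeierstrassCurve.b₆]
  ring

/-- `2c₆(y² = x³ + B) = (−12)³·B` is a cube iff `B` is. [folklore] -/
theorem exists_cube_two_mul_c₆_mk_a₆_iff (B : ℚ) :
    (∃ t : ℚ, t ^ 3 = 2 * (⟨0, 0, 0, 0, B⟩ : WeierstrassCurve ℚ).c₆) ↔ ∃ t : ℚ, t ^ 3 = B := by
  rw [c₆_mk_a₆]
  constructor
  · rintro ⟨t, ht⟩
    exact ⟨-t / 12, by linear_combination (-1 / 1728 : ℚ) * ht⟩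
  · rintro ⟨t, ht⟩
    exact ⟨-12 * t, by linear_combination (-1728 : ℚ) * ht⟩

/-- **`y² = x³ + B` (`B ≠ 0`): `ρ̄_{E,2}` onto ⟺ `B` is not a rational cube** (the `2`-division
cubic is `4(x³ + B)`; `Δ = −432B² ∉ ℚ^{×2}`). [cite: DokchitserDokchitserMathZ2012, Theorem (1)]
[cite: SilvermanAEC2009, III §1 and X §1] -/
theorem hasSurjectiveModNGaloisRep_two_sextic_iff {B : ℚ} (hB : B ≠ 0) :
    (⟨0, 0, 0, 0, B⟩ : WeierstrassCurve ℚ).HasSurjectiveModNGaloisRep 2 ↔ ¬ ∃ t : ℚ, t ^ 3 = B := by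
  haveI := isElliptic_of_j_zero_model hB
  rw [hasSurjectiveModNGaloisRep_two_iff_of_c₄_eq_zero _ (c₄_mk_a₆ B),
    exists_cube_two_mul_c₆_mk_a₆_iff]

/-- **`y² = x³ + B` (`B ≠ 0`): no rational point of order `2` ⟺ `B ∉ ℚ³.**
[cite: SilvermanAEC2009, III §1 and X §1] -/
theorem forall_two_nsmul_sextic_iff {B : ℚ} (hB : B ≠ 0) :
    (∀ P : (⟨0, 0, 0, 0, B⟩ : WeierstrassCurve ℚ).toAffine.Point, 2 • P = 0 → P = 0) ↔
      ¬ ∃ t : ℚ, t ^ 3 = B := by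
  haveI := isElliptic_of_j_zero_model hB
  rw [forall_two_nsmul_iff_not_exists_cube_of_c₄_eq_zero _ (c₄_mk_a₆ B),
    exists_cube_two_mul_c₆_mk_a₆_iff]

/-- **A valuation obstruction to being a cube**: if `r ≠ 0` and `3 ∤ ord_p(r)` for some prime `p`,
then `r` is not a rational cube (`ord_p(t³) = 3·ord_p(t)`). [folklore] -/
theorem not_exists_pow_three_eq_of_padicValRat (p : ℕ) [Fact p.Prime] {r : ℚ} (hr : r ≠ 0)
    (h : ¬ (3 : ℤ) ∣ padicValRat p r) : ¬ ∃ t : ℚ, t ^ 3 = r := by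
  rintro ⟨t, rfl⟩
  exact h ⟨padicValRat p t, by rw [padicValRat.pow]; push_cast; ring⟩

/-- `ord₂(n) = 0` for an odd integer `n`. [folklore] -/
theorem padicValRat_two_intCast_of_odd {n : ℤ} (hn : Odd n) : padicValRat 2 (n : ℚ) = 0 := by
  haveI : Fact (Nat.Prime 2) := ⟨Nat.prime_two⟩
  rw [padicValRat.of_int, padicValInt, padicValNat.eq_zero_of_not_dvd]
  · simp
  · intro h
    have he : Even n := Int.natAbs_even.mp (even_iff_two_dvd.mpr h)
    exact (Int.not_even_iff_odd.mpr hn) he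

/-- `ord₂(432) = 4` (`432 = 2⁴·27`). [folklore] -/
theorem padicValNat_two_432 : padicValNat 2 432 = 4 := by
  haveI : Fact (Nat.Prime 2) := ⟨Nat.prime_two⟩
  rw [show (432 : ℕ) = 2 ^ 4 * 27 by norm_num, padicValNat.mul (by norm_num) (by norm_num),
    padicValNat.prime_pow, padicValNat.eq_zero_of_not_dvd (by norm_num)]

/-- `ord₂(−432 n²) = 4` for an odd integer `n`. [folklore] -/
theorem padicValRat_two_cubeSum_a₆ {n : ℤ} (hn : Odd n) :
    padicValRat 2 (-432 * (n : ℚ) ^ 2) = 4 := by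
  haveI : Fact (Nat.Prime 2) := ⟨Nat.prime_two⟩
  have hn0 : (n : ℚ) ≠ 0 := by
    have : n ≠ 0 := by rintro rfl; exact absurd hn (by decide)
    exact_mod_cast this
  have h432 : padicValRat 2 (-432 : ℚ) = 4 := by
    rw [padicValRat.neg, show (432 : ℚ) = ((432 : ℕ) : ℚ) by norm_num, padicValRat.of_nat,
      padicValNat_two_432]
    norm_num
  rw [padicValRat.mul (by norm_num) (pow_ne_zero 2 hn0), h432, padicValRat.pow,
    padicValRat_two_intCast_of_odd hn]
  simp

/-- **Cube sums `x³ + y³ = n`, `n` ODD: `ρ̄_{E,2}` is onto** on the Hu–Shu–Yin model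
`E_n : y² = x³ − 432n²` (`−432n²` is not a cube: `ord₂ = 4`). In particular every Sylvester curve
`x³ + y³ = p` (`p` an odd prime) and every odd cube-free `n` satisfy the image binder of `H₂`.
[cite: HuShuYin2019, p. 4 (the model y² = x³ − 432n²)] [cite: DokchitserDokchitserMathZ2012, Theorem (1)] -/
theorem hasSurjectiveModNGaloisRep_two_cubeSumCurve_of_odd {n : ℤ} (hn : Odd n) :
    (HuShuYin2019.cubeSumCurve (n : ℚ)).HasSurjectiveModNGaloisRep 2 := by
  haveI : Fact (Nat.Prime 2) := ⟨Nat.prime_two⟩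
  have hn0 : (n : ℚ) ≠ 0 := by
    have : n ≠ 0 := by rintro rfl; exact absurd hn (by decide)
    exact_mod_cast this
  have hB : (-432 * (n : ℚ) ^ 2) ≠ 0 := mul_ne_zero (by norm_num) (pow_ne_zero 2 hn0)
  rw [HuShuYin2019.cubeSumCurve, hasSurjectiveModNGaloisRep_two_sextic_iff hB]
  refine not_exists_pow_three_eq_of_padicValRat 2 hB ?_
  rw [padicValRat_two_cubeSum_a₆ hn]
  decide

/-- `2c₆` scales by the cube `(u⁻²)³` under a change of variables, so «`2c₆ ∈ ℚ³`» is a property of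
the isomorphism class. [cite: SilvermanAEC2009, III §1 Table 3.1 (u⁶c₆' = c₆)] -/
theorem exists_cube_two_mul_c₆_smul_iff (V : WeierstrassCurve ℚ) (C : VariableChange ℚ) :
    (∃ t : ℚ, t ^ 3 = 2 * (C • V).c₆) ↔ ∃ t : ℚ, t ^ 3 = 2 * V.c₆ := by
  have hu : ((C.u⁻¹ : ℚˣ) : ℚ) ≠ 0 := Units.ne_zero _
  rw [variableChange_c₆]
  constructor
  · rintro ⟨t, ht⟩
    refine ⟨t / ((C.u⁻¹ : ℚˣ) : ℚ) ^ 2, ?_⟩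
    field_simp
    linear_combination ht
  · rintro ⟨t, ht⟩
    exact ⟨t * ((C.u⁻¹ : ℚˣ) : ℚ) ^ 2, by linear_combination ((C.u⁻¹ : ℚˣ) : ℚ) ^ 6 * ht⟩

/-- **`j = 0`, any model in the isomorphism class**: if `C • V = W` with `c₄(V) = 0` then
`ρ̄_{W,2}` onto ⟺ `2c₆(V) ∉ ℚ³` (read the criterion on the convenient model `V`).
[cite: DokchitserDokchitserMathZ2012, Theorem (1)] [cite: SilvermanAEC2009, III §1] -/
theorem hasSurjectiveModNGaloisRep_two_iff_of_smul_eq {V : WeierstrassCurve ℚ} {C : VariableChange ℚ}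
    (hC : C • V = W) (hc₄ : V.c₄ = 0) :
    W.HasSurjectiveModNGaloisRep 2 ↔ ¬ ∃ t : ℚ, t ^ 3 = 2 * V.c₆ := by
  have hc₄W : W.c₄ = 0 := by
    rw [← hC, variableChange_c₄, hc₄, mul_zero]
  rw [hasSurjectiveModNGaloisRep_two_iff_of_c₄_eq_zero W hc₄W, ← hC, exists_cube_two_mul_c₆_smul_iff]

/-- **Cube sums `x³ + y³ = n`, `n` ODD, on EVERY `ℚ`-model** (e.g. a globally minimal one, as in
the items): `ρ̄_{E,2}` is onto. [cite: HuShuYin2019, p. 4] [cite: DokchitserDokchitserMathZ2012, Theorem (1)] -/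
theorem hasSurjectiveModNGaloisRep_two_of_smul_cubeSumCurve_of_odd {n : ℤ} (hn : Odd n)
    {C : VariableChange ℚ} (hC : C • HuShuYin2019.cubeSumCurve (n : ℚ) = W) :
    W.HasSurjectiveModNGaloisRep 2 := by
  haveI : Fact (Nat.Prime 2) := ⟨Nat.prime_two⟩
  have hn0 : (n : ℚ) ≠ 0 := by
    have : n ≠ 0 := by rintro rfl; exact absurd hn (by decide)
    exact_mod_cast this
  have hB : (-432 * (n : ℚ) ^ 2) ≠ 0 := mul_ne_zero (by norm_num) (pow_ne_zero 2 hn0)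
  rw [hasSurjectiveModNGaloisRep_two_iff_of_smul_eq W hC (HuShuYin2019.cubeSumCurve_c₄ _),
    show HuShuYin2019.cubeSumCurve (n : ℚ) = ⟨0, 0, 0, 0, -432 * (n : ℚ) ^ 2⟩ from rfl,
    exists_cube_two_mul_c₆_mk_a₆_iff]
  refine not_exists_pow_three_eq_of_padicValRat 2 hB ?_
  rw [padicValRat_two_cubeSum_a₆ hn]
  decide

/-- `x³ + y³ = 2` (`36a1`: `y² = x³ − 1728`, `−1728 = (−12)³`): `ρ̄_{E,2}` is NOT onto — the point
`(12, 0)` has order `2`; this curve and its Shu–Zhai twists are off `H₂` (residual). [cite: HuShuYin2019, p. 4]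
[cite: DokchitserDokchitserMathZ2012, Theorem (1)] -/
theorem not_hasSurjectiveModNGaloisRep_two_cubeSumCurve_two :
    ¬ (HuShuYin2019.cubeSumCurve 2).HasSurjectiveModNGaloisRep 2 := by
  have hB : (-432 * (2 : ℚ) ^ 2) ≠ 0 := by norm_num
  rw [HuShuYin2019.cubeSumCurve, hasSurjectiveModNGaloisRep_two_sextic_iff hB, not_not]
  exact ⟨-12, by norm_num⟩

end Sextic

/-! ## §4 `j = 1728`: never onto -/

/-- **`j = 1728` (`y² = x³ + Ax`, CM by `ℤ[i]`, `2` ramified): `ρ̄_{E,2}` is never onto** — there is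
always a rational point of order `2` (tree `X12.exists_twoTorsion_of_j_eq_1728`). So the
congruent-number corner lies outside the habitat `H₂`. [cite: DokchitserDokchitserMathZ2012, Theorem (1)]
[cite: SilvermanAEC2009, X §6 (y² = x³ + Dx)] -/
theorem not_hasSurjectiveModNGaloisRep_two_of_j_eq_1728 (hj : W.j = 1728) :
    ¬ W.HasSurjectiveModNGaloisRep 2 := by
  intro hs
  obtain ⟨P, hP0, h2P⟩ := X12.exists_twoTorsion_of_j_eq_1728 W hj
  exact hP0 (((hasSurjectiveModNGaloisRep_two_iff W).mp hs).1 P h2P)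

/-! ## §5 CM with `j ∉ {0, 1728}`: the table -/

/-- **CM, `j ≠ 0`: `ρ̄_{E,2}` onto ⟺ NOT (`d ∈ {−4, −7, −8}` or `j = 54000`)** — Dokchitser–Dokchitser
(1) with the tree's rational-`2`-torsion table of the twelve CM `j`-invariants `≠ 0`
(`X12.exists_twoTorsion_iff_of_cm_j_ne_zero`) and `hasSurjectiveModNGaloisRep_two_of_hasCM`.
[cite: DokchitserDokchitserMathZ2012, Theorem (1)] [cite: SilvermanAEC2009, App. A §3] -/
theorem hasSurjectiveModNGaloisRep_two_iff_of_hasCM_of_j_ne_zero (hCM : W.HasCM) (hj0 : W.j ≠ 0) :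
    W.HasSurjectiveModNGaloisRep 2 ↔
      ¬ (cmFieldDiscrOfJ W.j = -4 ∨ cmFieldDiscrOfJ W.j = -7 ∨ cmFieldDiscrOfJ W.j = -8 ∨
        W.j = 54000) := by
  have hcm := X12.cmFieldDiscrOfJ_ne_zero_of_hasCM W hCM
  rw [← X12.exists_twoTorsion_iff_of_cm_j_ne_zero W hcm hj0]
  constructor
  · rintro hs ⟨P, hP0, h2P⟩
    exact hP0 (((hasSurjectiveModNGaloisRep_two_iff W).mp hs).1 P h2P)
  · intro h
    refine hasSurjectiveModNGaloisRep_two_of_hasCM W hCM fun P h2P ↦ ?_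
    by_contra hP0
    exact h ⟨P, hP0, h2P⟩

/-- **CM, `2` INERT in the CM field, `j ≠ 0`: `ρ̄_{E,2}` onto ⟺ `j ≠ 54000`** (the inert
discriminants are `−3, −11, −19, −43, −67, −163`, tree `cmInert_two_iff_of_hasCM`; of the inert
`j ≠ 0` only `54000` carries a rational `2`-torsion point). [cite: DokchitserDokchitserMathZ2012, Theorem (1)]
[cite: SilvermanAEC2009, App. A §3] -/
theorem hasSurjectiveModNGaloisRep_two_iff_of_cmInert_two_of_j_ne_zero (hCM : W.HasCM)
    (hin : CMInert W 2) (hj0 : W.j ≠ 0) : W.HasSurjectiveModNGaloisRep 2 ↔ W.j ≠ 54000 := by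
  rw [hasSurjectiveModNGaloisRep_two_iff_of_hasCM_of_j_ne_zero W hCM hj0]
  have hd := (cmInert_two_iff_of_hasCM hCM).mp hin
  constructor
  · exact fun h h54 ↦ h (Or.inr (Or.inr (Or.inr h54)))
  · rintro h54 (h | h | h | h)
    · rcases hd with hd | hd | hd | hd | hd | hd <;> rw [hd] at h <;> norm_num at h
    · rcases hd with hd | hd | hd | hd | hd | hd <;> rw [hd] at h <;> norm_num at h
    · rcases hd with hd | hd | hd | hd | hd | hd <;> rw [hd] at h <;> norm_num at h
    · exact h54 h

/-- **The image binder of `H₂` on the whole inert slice.** For a CM curve with `2` inert in the CM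
field: `ρ̄_{E,2}` onto ⟺ `j ≠ 54000` ∧ (`j = 0` → `2c₆ ∉ ℚ³`) — i.e. onto exactly for the five odd
inert fields (`j ∈ {−32768, −884736, −884736000, −147197952000, −262537412640768000}`),
`j = −12288000`, and the `j = 0` twists `y² = x³ + B` with `B ∉ ℚ³`.
[cite: DokchitserDokchitserMathZ2012, Theorem (1)] [cite: SilvermanAEC2009, III §1 and App. A §3] -/
theorem hasSurjectiveModNGaloisRep_two_iff_of_cmInert_two (hCM : W.HasCM) (hin : CMInert W 2) :
    W.HasSurjectiveModNGaloisRep 2 ↔ W.j ≠ 54000 ∧ (W.j = 0 → ¬ ∃ t : ℚ, t ^ 3 = 2 * W.c₆) := by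
  by_cases hj0 : W.j = 0
  · rw [hasSurjectiveModNGaloisRep_two_iff_of_j_eq_zero W hj0, hj0]
    norm_num
  · rw [hasSurjectiveModNGaloisRep_two_iff_of_cmInert_two_of_j_ne_zero W hCM hin hj0]
    simp [hj0]

end Summit.BirchSwinnertonDyer.Rank1Residual.P2
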